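import Literature.NumberTheory.LFunctions.CubicRayClassGenerators
import Literature.NumberTheory.Automorphic.GaloisActionPlaces
import Literature.NumberTheory.QuadraticFields.ConjugateIdealClass
import Mathlib.NumberTheory.NumberField.Discriminant.Different
import Mathlib.NumberTheory.RamificationInertia.Galois
import Mathlib.RingTheory.Ideal.Int
import Mathlib.FieldTheory.Finite.Basic
import HarnessLib

/-!
# Generators of the units modulo `𝔪₀` over a quadratic field, modulo rational integers

`Proofs` file (theorems only), topic `Literature/NumberTheory/LFunctions`, the input `hgen` of
`CubicRayClassCharacterCount.ncard_cubicRayClassFunctions_le` in the RING CLASS situation: `K` a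
quadratic field, `d ≠ 0` an integer, `T` the primes of `K` dividing `3d`, `Z` the rational integers
prime to `T`.  Then there is a finite set `S ⊆ 𝓞_K` of integers prime to `T` with
`#S ≤ #(𝓞_K/9) + #{p ∣ d : p ∤ d_K}` such that every `x ∈ 𝓞_K` prime to `T` is
`≡ a · ∏_{s ∈ S} s^{n_s} mod 𝔪₀` for a rational integer `a` prime to `T`
(`exists_generators_baseModulus_quadratic`): modulo a split prime `p = 𝔭 σ𝔭` one takes `a ≡ x mod σ𝔭`
and a generator of `(𝓞_K/𝔭)ˣ`; modulo an inert prime a generator of `(𝓞_K/p)ˣ`; modulo a RAMIFIED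
prime `p = 𝔭²`, `𝓞_K/𝔭 = 𝔽_p` is exhausted by the rational integers and no generator is needed — this
is why only `ω(f)` (and not `ω(D₀ f²)`) enters the `3`-rank bound for the ring class group of conductor
`f` (Belabas–Bhargava–Pomerance 2010, proof of Lemma 3.3: "the 3-rank of the ring class group modulo
`q` is bounded by `ω(q) + r₃(D) + O(1)`").  The decomposition of rational primes in a quadratic field
is obtained from `(p) = ∏ 𝔮^{e_𝔮}` and norms (`quadratic_trichotomy`), and "`p ∣ d_K ⇒ p = 𝔭²`" from
the different (`Mathlib.not_dvd_differentIdeal_of_isCoprime`).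

## References

* K. Belabas, M. Bhargava, C. Pomerance, *Error estimates for the Davenport–Heilbronn theorems*, Duke
  Math. J. 153 (2010), proof of Lemma 3.3 [BelabasBhargavaPomerance2010].
* D. A. Marcus, *Number Fields*, Ch. 3, Thm. 25 (decomposition in quadratic fields) [Marcus2018].
-/

noncomputable section

open IsDedekindDomain IsDedekindDomain.HeightOneSpectrum NumberField Finset
open Literature.NumberTheory.Automorphic Literature.NumberTheory.QuadraticFields
open scoped nonZeroDivisors Pointwise

namespace Literature.NumberTheory.LFunctions

variable {K : Type*} [Field K] [NumberField K]

/-! ### Rational primes below a prime of `K` -/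

/-- **The rational prime below `𝔭`**: there is a prime `ℓ` with `m ∈ 𝔭 ↔ ℓ ∣ m` for rational
integers `m`. [folklore] -/
theorem exists_ratPrime (v : HeightOneSpectrum (𝓞 K)) :
    ∃ ℓ : ℕ, ℓ.Prime ∧ ∀ m : ℤ, ((m : ℤ) : 𝓞 K) ∈ v.asIdeal ↔ (ℓ : ℤ) ∣ m := by
  set ℓ := Ideal.absNorm (v.asIdeal.under ℤ) with hℓ
  have hiff : ∀ m : ℤ, ((m : ℤ) : 𝓞 K) ∈ v.asIdeal ↔ (ℓ : ℤ) ∣ m := fun m => Int.cast_mem_ideal_iff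
  refine ⟨ℓ, ?_, hiff⟩
  have hN0 : Ideal.absNorm v.asIdeal ≠ 0 := by
    rw [Ne, Ideal.absNorm_eq_zero_iff]; exact v.ne_bot
  have hℓN : (ℓ : ℤ) ∣ (Ideal.absNorm v.asIdeal : ℤ) := by
    rw [← hiff, Int.cast_natCast]; exact Ideal.absNorm_mem _
  have hℓ0 : ℓ ≠ 0 := by
    rintro h0
    rw [h0, Nat.cast_zero, zero_dvd_iff, Nat.cast_eq_zero] at hℓN
    exact hN0 hℓN
  have hℓ1 : ℓ ≠ 1 := by
    intro h1
    have : ((1 : ℤ) : 𝓞 K) ∈ v.asIdeal := by rw [hiff, h1]; simp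
    rw [Int.cast_one] at this
    exact v.isPrime.ne_top ((Ideal.eq_top_iff_one _).mpr this)
  rw [Nat.prime_iff_prime_int]
  refine ⟨by exact_mod_cast hℓ0, fun h => hℓ1 (by
    rcases Int.isUnit_iff.mp h with h | h <;> omega), fun a b hab => ?_⟩
  rw [← hiff, Int.cast_mul] at hab
  rw [← hiff, ← hiff]
  exact v.isPrime.mem_or_mem hab

omit [NumberField K] in
/-- Two distinct rational primes do not lie in a common prime of `K`. [folklore] -/
theorem not_mem_of_prime_ne {p q : ℕ} (hp : p.Prime) (hq : q.Prime) (hpq : p ≠ q)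
    (v : HeightOneSpectrum (𝓞 K)) (hpv : ((p : ℤ) : 𝓞 K) ∈ v.asIdeal) : ((q : ℤ) : 𝓞 K) ∉ v.asIdeal := by
  intro hqv
  have hcop : IsCoprime (p : ℤ) (q : ℤ) := by
    rw [Int.isCoprime_iff_gcd_eq_one, Int.gcd_natCast_natCast]
    exact (Nat.coprime_primes hp hq).mpr hpq
  obtain ⟨a, b, hab⟩ := hcop
  apply v.isPrime.ne_top
  rw [Ideal.eq_top_iff_one]
  have : (1 : 𝓞 K) = (a : 𝓞 K) * ((p : ℤ) : 𝓞 K) + (b : 𝓞 K) * ((q : ℤ) : 𝓞 K) := by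
    exact_mod_cast congrArg (fun z : ℤ => (z : 𝓞 K)) hab.symm
  rw [this]
  exact v.asIdeal.add_mem (v.asIdeal.mul_mem_left _ hpv) (v.asIdeal.mul_mem_left _ hqv)

omit [NumberField K] in
/-- A prime `𝔭 ∋ p` lies over `(p)`. [folklore] -/
theorem under_eq_span_of_mem {p : ℕ} (hp : p.Prime) (v : HeightOneSpectrum (𝓞 K))
    (hv : ((p : ℤ) : 𝓞 K) ∈ v.asIdeal) : v.asIdeal.under ℤ = Ideal.span {(p : ℤ)} := by
  have hpprime : (Ideal.span {(p : ℤ)}).IsPrime :=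
    (Ideal.span_singleton_prime (by exact_mod_cast hp.ne_zero)).mpr (Nat.prime_iff_prime_int.mp hp)
  have hp0 : Ideal.span {(p : ℤ)} ≠ ⊥ := by
    rw [Ne, Ideal.span_singleton_eq_bot]; exact_mod_cast hp.ne_zero
  haveI hpmax : (Ideal.span {(p : ℤ)}).IsMaximal := hpprime.isMaximal hp0
  haveI := v.isPrime
  refine (hpmax.eq_of_le (Ideal.IsPrime.under ℤ v.asIdeal).ne_top fun x hx => ?_).symm
  rw [Ideal.mem_span_singleton] at hx
  obtain ⟨c, rfl⟩ := hx
  rw [Ideal.mem_comap, map_mul, eq_intCast, eq_intCast]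
  exact Ideal.mul_mem_right _ _ hv

/-- Every rational prime has a prime of `K` above it. [folklore] -/
theorem exists_mem_of_prime {p : ℕ} (hp : p.Prime) :
    ∃ v : HeightOneSpectrum (𝓞 K), ((p : ℤ) : 𝓞 K) ∈ v.asIdeal := by
  haveI hpmax : (Ideal.span {(p : ℤ)}).IsMaximal :=
    ((Ideal.span_singleton_prime (by exact_mod_cast hp.ne_zero)).mpr (Nat.prime_iff_prime_int.mp hp)).isMaximal
      (by rw [Ne, Ideal.span_singleton_eq_bot]; exact_mod_cast hp.ne_zero)
  obtain ⟨Q, hQmax, hQover⟩ :=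
    Ideal.exists_maximal_ideal_liesOver_of_isIntegral (S := 𝓞 K) (Ideal.span {(p : ℤ)})
  refine ⟨⟨Q, hQmax.isPrime, Ideal.IsMaximal.ne_bot_of_isIntegral_int Q⟩, ?_⟩
  have : (p : ℤ) ∈ Q.under ℤ := by rw [← hQover.over]; exact Ideal.mem_span_singleton_self _
  rw [Ideal.mem_comap, eq_intCast] at this
  exact this

/-- `#(𝓞_K/𝔭) = N(𝔭)`. [folklore] -/
theorem absNorm_eq_card (I : Ideal (𝓞 K)) : Ideal.absNorm I = Nat.card (𝓞 K ⧸ I) := by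
  rw [Ideal.absNorm_apply, Submodule.cardQuot_apply]

/-- **`N((p)) = p^{[K:ℚ]}`**. [folklore] -/
theorem absNorm_span_natCast (p : ℕ) :
    Ideal.absNorm (Ideal.span {((p : ℤ) : 𝓞 K)}) = p ^ Module.finrank ℚ K := by
  rw [Ideal.absNorm_span_singleton, show ((p : ℤ) : 𝓞 K) = algebraMap ℤ (𝓞 K) (p : ℤ) from
    (eq_intCast _ _).symm, Algebra.norm_algebraMap, RingOfIntegers.rank, Int.natAbs_pow,
    Int.natAbs_natCast]

/-- The norm of a prime `𝔭 ∋ p` of a quadratic field is `p` or `p²`. [folklore] -/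
theorem absNorm_eq_or_of_mem (hK : Module.finrank ℚ K = 2) {p : ℕ} (hp : p.Prime)
    (v : HeightOneSpectrum (𝓞 K)) (hv : ((p : ℤ) : 𝓞 K) ∈ v.asIdeal) :
    Ideal.absNorm v.asIdeal = p ∨ Ideal.absNorm v.asIdeal = p ^ 2 := by
  have hdvd : Ideal.absNorm v.asIdeal ∣ p ^ 2 := by
    rw [← hK, ← absNorm_span_natCast (K := K) p]
    exact Ideal.absNorm_dvd_absNorm_of_le ((Ideal.span_singleton_le_iff_mem _).mpr hv)
  obtain ⟨i, hi, hN⟩ := (Nat.dvd_prime_pow hp).mp hdvd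
  have hi0 : i ≠ 0 := by
    rintro rfl
    rw [pow_zero, Ideal.absNorm_eq_one_iff] at hN
    exact v.isPrime.ne_top hN
  interval_cases i
  · exact absurd rfl hi0
  · exact Or.inl (by rw [hN, pow_one])
  · exact Or.inr hN

/-- **Fermat in the residue field**: `a ∉ 𝔭 ⇒ a^{N𝔭 - 1} ≡ 1 mod 𝔭`. [folklore] -/
theorem pow_absNorm_sub_one_sub_one_mem (v : HeightOneSpectrum (𝓞 K)) {a : 𝓞 K}
    (ha : a ∉ v.asIdeal) : a ^ (Ideal.absNorm v.asIdeal - 1) - 1 ∈ v.asIdeal := by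
  classical
  haveI := v.isMaximal
  letI : Field (𝓞 K ⧸ v.asIdeal) := Ideal.Quotient.field v.asIdeal
  haveI : Finite (𝓞 K ⧸ v.asIdeal) := Ideal.finiteQuotientOfFreeOfNeBot v.asIdeal v.ne_bot
  letI : Fintype (𝓞 K ⧸ v.asIdeal) := Fintype.ofFinite _
  have ha0 : Ideal.Quotient.mk v.asIdeal a ≠ 0 := by
    rw [Ne, Ideal.Quotient.eq_zero_iff_mem]; exact ha
  have h := FiniteField.pow_card_sub_one_eq_one (Ideal.Quotient.mk v.asIdeal a) ha0
  rw [Fintype.card_eq_nat_card, ← absNorm_eq_card] at h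
  rw [← Ideal.Quotient.eq, map_pow, map_one]
  exact h

/-- **Integer representatives modulo a degree-one prime**: if `N𝔭 = p ∈ 𝔭` then every residue class
modulo `𝔭` contains a rational integer. [folklore] -/
theorem exists_int_sub_mem {p : ℕ} (hp : p.Prime) (v : HeightOneSpectrum (𝓞 K))
    (hv : ((p : ℤ) : 𝓞 K) ∈ v.asIdeal) (hN : Ideal.absNorm v.asIdeal = p) (x : 𝓞 K) :
    ∃ a : ℤ, x - a ∈ v.asIdeal := by
  classical
  haveI : Finite (𝓞 K ⧸ v.asIdeal) := Ideal.finiteQuotientOfFreeOfNeBot v.asIdeal v.ne_bot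
  letI : Fintype (𝓞 K ⧸ v.asIdeal) := Fintype.ofFinite _
  set g : Fin p → 𝓞 K ⧸ v.asIdeal := fun i => Ideal.Quotient.mk v.asIdeal ((i : ℕ) : 𝓞 K) with hg
  have hinj : Function.Injective g := by
    intro i j hij
    simp only [hg, Ideal.Quotient.eq] at hij
    by_contra hne
    have hne' : (i : ℕ) ≠ (j : ℕ) := fun h => hne (Fin.ext h)
    -- `i - j ∈ 𝔭 ∩ ℤ = (p)`, `0 < |i - j| < p`
    have hmem : (((i : ℤ) - (j : ℤ) : ℤ) : 𝓞 K) ∈ v.asIdeal := by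
      rw [Int.cast_sub, Int.cast_natCast, Int.cast_natCast]; exact hij
    have hdvd : (p : ℤ) ∣ (i : ℤ) - (j : ℤ) := by
      have := Ideal.mem_comap.mpr (show algebraMap ℤ (𝓞 K) ((i : ℤ) - (j : ℤ)) ∈ v.asIdeal by
        rwa [eq_intCast])
      change ((i : ℤ) - (j : ℤ)) ∈ v.asIdeal.under ℤ at this
      rw [under_eq_span_of_mem hp v hv, Ideal.mem_span_singleton] at this
      exact this
    have h1 := Int.eq_zero_of_abs_lt_dvd hdvd (by
      have hi := i.isLt; have hj := j.isLt
      rw [abs_lt]; constructor <;> omega)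
    exact hne' (by omega)
  have hcard : Fintype.card (Fin p) = Fintype.card (𝓞 K ⧸ v.asIdeal) := by
    rw [Fintype.card_fin, Fintype.card_eq_nat_card, ← absNorm_eq_card, hN]
  have hsurj : Function.Surjective g :=
    ((Fintype.bijective_iff_injective_and_card g).mpr ⟨hinj, hcard⟩).2
  obtain ⟨i, hi⟩ := hsurj (Ideal.Quotient.mk v.asIdeal x)
  refine ⟨(i : ℕ), ?_⟩
  rw [← Ideal.Quotient.eq, ← hi, hg, Int.cast_natCast]

/-! ### Decomposition of rational primes in a quadratic field -/

section Quadratic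

variable [IsGalois ℚ K]

omit [IsGalois ℚ K] in
/-- The Galois action fixes rational integers: `m ∈ σ𝔭 ↔ m ∈ 𝔭`. [folklore] -/
theorem intCast_mem_smul_iff (σ : K ≃ₐ[ℚ] K) (v : HeightOneSpectrum (𝓞 K)) (m : ℤ) :
    ((m : ℤ) : 𝓞 K) ∈ (σ • v).asIdeal ↔ ((m : ℤ) : 𝓞 K) ∈ v.asIdeal := by
  rw [HeightOneSpectrum.smul_asIdeal, Ideal.mem_pointwise_smul_iff_inv_smul_mem]
  have : σ⁻¹ • ((m : ℤ) : 𝓞 K) = ((m : ℤ) : 𝓞 K) := by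
    apply RingOfIntegers.ext
    change σ⁻¹ • (((m : ℤ) : 𝓞 K) : K) = (((m : ℤ) : 𝓞 K) : K)
    rw [AlgEquiv.smul_def, show (((m : ℤ) : 𝓞 K) : K) = ((m : ℤ) : K) from map_intCast _ _, map_intCast]
  rw [this]

/-- A quadratic field has a non-trivial automorphism. [folklore] -/
theorem exists_ne_one_of_finrank_eq_two (hK : Module.finrank ℚ K = 2) : ∃ σ : K ≃ₐ[ℚ] K, σ ≠ 1 := by
  have hG : Nat.card (K ≃ₐ[ℚ] K) = 2 := by rw [IsGalois.card_aut_eq_finrank, hK]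
  by_contra h
  push Not at h
  haveI : Subsingleton (K ≃ₐ[ℚ] K) := ⟨fun a b => by rw [h a, h b]⟩
  have := Nat.card_of_subsingleton (1 : K ≃ₐ[ℚ] K)
  omega

/-- The primes above `p` are the conjugates of any one of them. [folklore] -/
theorem eq_or_eq_smul_of_mem (hK : Module.finrank ℚ K = 2) (σ : K ≃ₐ[ℚ] K) (hσ : σ ≠ 1)
    {p : ℕ} (hp : p.Prime) (v : HeightOneSpectrum (𝓞 K)) (hv : ((p : ℤ) : 𝓞 K) ∈ v.asIdeal)
    (w : HeightOneSpectrum (𝓞 K)) (hw : ((p : ℤ) : 𝓞 K) ∈ w.asIdeal) : w = v ∨ w = σ • v := by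
  haveI : IsGaloisGroup (K ≃ₐ[ℚ] K) ℤ (𝓞 K) := IsGaloisGroup.of_isFractionRing (K ≃ₐ[ℚ] K) ℤ (𝓞 K) ℚ K
  have hG : Nat.card (K ≃ₐ[ℚ] K) = 2 := by rw [IsGalois.card_aut_eq_finrank, hK]
  haveI hpmax : (Ideal.span {(p : ℤ)}).IsMaximal :=
    ((Ideal.span_singleton_prime (by exact_mod_cast hp.ne_zero)).mpr (Nat.prime_iff_prime_int.mp hp)).isMaximal
      (by rw [Ne, Ideal.span_singleton_eq_bot]; exact_mod_cast hp.ne_zero)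
  haveI := v.isPrime
  haveI := w.isPrime
  haveI : v.asIdeal.LiesOver (Ideal.span {(p : ℤ)}) := ⟨(under_eq_span_of_mem hp v hv).symm⟩
  haveI : w.asIdeal.LiesOver (Ideal.span {(p : ℤ)}) := ⟨(under_eq_span_of_mem hp w hw).symm⟩
  obtain ⟨ρ, hρ⟩ := Ideal.exists_smul_eq_of_isGaloisGroup (Ideal.span {(p : ℤ)}) v.asIdeal w.asIdeal (K ≃ₐ[ℚ] K)
  rcases eq_one_or_eq_of_card_eq_two hG hσ ρ with h | h
  · left
    exact HeightOneSpectrum.ext (by rw [← hρ, h, one_smul])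
  · right
    exact HeightOneSpectrum.ext (by rw [HeightOneSpectrum.smul_asIdeal, ← hρ, h])

/-- **Decomposition of a rational prime in a quadratic field** (`efg = 2`): for `𝔭 ∋ p` and `σ` the
non-trivial automorphism, either `p` SPLITS, `(p) = 𝔭 · σ𝔭` with `σ𝔭 ≠ 𝔭` and `N𝔭 = p`; or `p` is
INERT, `(p) = 𝔭`; or `p` RAMIFIES, `(p) = 𝔭²` with `N𝔭 = p`.  From `(p) = ∏_{𝔮 ∣ p} 𝔮^{e_𝔮}`
(`Ideal.map_algebraMap_eq_finsetProd_pow`) and `N((p)) = p²`. [cite: Marcus2018, Ch. 3, Thm. 25] -/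
theorem quadratic_trichotomy (hK : Module.finrank ℚ K = 2) (σ : K ≃ₐ[ℚ] K) (hσ : σ ≠ 1)
    {p : ℕ} (hp : p.Prime) (v : HeightOneSpectrum (𝓞 K)) (hv : ((p : ℤ) : 𝓞 K) ∈ v.asIdeal) :
    (σ • v ≠ v ∧ Ideal.span {((p : ℤ) : 𝓞 K)} = v.asIdeal * (σ • v).asIdeal ∧
        Ideal.absNorm v.asIdeal = p) ∨
      (σ • v = v ∧ Ideal.span {((p : ℤ) : 𝓞 K)} = v.asIdeal) ∨
      (σ • v = v ∧ Ideal.span {((p : ℤ) : 𝓞 K)} = v.asIdeal ^ 2 ∧ Ideal.absNorm v.asIdeal = p) := by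
  classical
  haveI hpmax : (Ideal.span {(p : ℤ)}).IsMaximal :=
    ((Ideal.span_singleton_prime (by exact_mod_cast hp.ne_zero)).mpr (Nat.prime_iff_prime_int.mp hp)).isMaximal
      (by rw [Ne, Ideal.span_singleton_eq_bot]; exact_mod_cast hp.ne_zero)
  have hp0 : Ideal.span {(p : ℤ)} ≠ ⊥ := by
    rw [Ne, Ideal.span_singleton_eq_bot]; exact_mod_cast hp.ne_zero
  set P := v.asIdeal with hPdef
  have hσv : ((p : ℤ) : 𝓞 K) ∈ (σ • v).asIdeal := (intCast_mem_smul_iff σ v p).mpr hv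
  -- primes over `p`
  have hover : ∀ w : HeightOneSpectrum (𝓞 K), ((p : ℤ) : 𝓞 K) ∈ w.asIdeal →
      w.asIdeal ∈ (Ideal.span {(p : ℤ)}).primesOver (𝓞 K) := fun w hw =>
    ⟨w.isPrime, ⟨(under_eq_span_of_mem hp w hw).symm⟩⟩
  have hover' : ∀ Q ∈ (Ideal.span {(p : ℤ)}).primesOver (𝓞 K), Q = v.asIdeal ∨ Q = (σ • v).asIdeal := by
    intro Q hQ
    have hQ0 : Q ≠ ⊥ := by
      haveI := hQ.1
      haveI := hQ.2
      exact Ideal.ne_bot_of_liesOver_of_ne_bot hp0 Q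
    set w : HeightOneSpectrum (𝓞 K) := ⟨Q, hQ.1, hQ0⟩
    have hw : ((p : ℤ) : 𝓞 K) ∈ w.asIdeal := by
      have : (p : ℤ) ∈ Q.under ℤ := by
        haveI := hQ.2
        rw [← Ideal.LiesOver.over (p := Ideal.span {(p : ℤ)}) (P := Q)]
        exact Ideal.mem_span_singleton_self _
      rw [Ideal.mem_comap, eq_intCast] at this
      exact this
    rcases eq_or_eq_smul_of_mem hK σ hσ hp v hv w hw with h | h
    · exact Or.inl (congrArg HeightOneSpectrum.asIdeal h)
    · exact Or.inr (congrArg HeightOneSpectrum.asIdeal h)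
  -- the factorisation of `(p)` and norms
  have hfac := Ideal.map_algebraMap_eq_finsetProd_pow (R := 𝓞 K) hp0
  have hmap : (Ideal.span {(p : ℤ)}).map (algebraMap ℤ (𝓞 K)) = Ideal.span {((p : ℤ) : 𝓞 K)} := by
    rw [Ideal.map_span, Set.image_singleton, eq_intCast]
  have hNp : Ideal.absNorm (Ideal.span {((p : ℤ) : 𝓞 K)}) = p ^ 2 := by
    rw [absNorm_span_natCast p, hK]
  have hN := absNorm_eq_or_of_mem hK hp v hv
  have hNσ : Ideal.absNorm (σ • v).asIdeal = Ideal.absNorm v.asIdeal := by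
    rw [absNorm_eq_card, absNorm_eq_card, HeightOneSpectrum.card_quotient_smul]
  have he : ∀ Q : Ideal (𝓞 K), Q.IsPrime → 1 ≤ Q.ramificationIdx ℤ := fun Q hQ => by
    haveI := hQ; exact Ideal.ramificationIdx_pos Q ℤ
  have hpinj : Function.Injective (fun n : ℕ => p ^ n) := Nat.pow_right_injective hp.two_le
  by_cases hfix : σ • v = v
  · -- one prime over `p`: `(p) = P^e`, `p² = N^e`
    right
    have hset : (Ideal.span {(p : ℤ)}).primesOver (𝓞 K) = {P} := by
      ext Q
      simp only [Set.mem_singleton_iff]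
      refine ⟨fun hQ => ?_, fun h => h ▸ hover v hv⟩
      rcases hover' Q hQ with h | h
      · exact h
      · rw [h, hfix]
    rw [hmap] at hfac
    simp only [hset, Set.toFinset_singleton, Finset.prod_singleton] at hfac
    set e := P.ramificationIdx ℤ with hedef
    have he1 : 1 ≤ e := he P v.isPrime
    have hnorm : p ^ 2 = Ideal.absNorm P ^ e := by rw [← hNp, hfac, map_pow]
    rcases hN with hN | hN
    · -- ramified
      rw [hN] at hnorm
      have he2 : e = 2 := (hpinj hnorm).symm
      exact Or.inr ⟨hfix, by rw [hfac, he2], hN⟩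
    · -- inert
      rw [hN, ← pow_mul] at hnorm
      have he1' : e = 1 := by have := hpinj hnorm; omega
      exact Or.inl ⟨hfix, by rw [hfac, he1', pow_one]⟩
  · -- two primes over `p`: `(p) = P^{e₁} (σP)^{e₂}`, `p² = N^{e₁ + e₂}`
    left
    have hne : P ≠ (σ • v).asIdeal := fun h => hfix (HeightOneSpectrum.ext h.symm)
    have hset : (Ideal.span {(p : ℤ)}).primesOver (𝓞 K) = {P, (σ • v).asIdeal} := by
      ext Q
      simp only [Set.mem_insert_iff, Set.mem_singleton_iff]
      refine ⟨hover' Q, fun h => ?_⟩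
      rcases h with rfl | rfl
      · exact hover v hv
      · exact hover _ hσv
    rw [hmap] at hfac
    simp only [hset, Set.toFinset_insert, Set.toFinset_singleton] at hfac
    rw [Finset.prod_insert (by simpa using hne), Finset.prod_singleton] at hfac
    set e₁ := P.ramificationIdx ℤ with he₁
    set e₂ := (σ • v).asIdeal.ramificationIdx ℤ with he₂
    have h1 : 1 ≤ e₁ := he P v.isPrime
    have h2 : 1 ≤ e₂ := he _ (σ • v).isPrime
    have hnorm : p ^ 2 = Ideal.absNorm P ^ (e₁ + e₂) := by
      rw [← hNp, hfac, map_mul, map_pow, map_pow, hNσ, ← pow_add]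
    rcases hN with hN | hN
    · rw [hN] at hnorm
      have h12 : e₁ + e₂ = 2 := (hpinj hnorm).symm
      have h11 : e₁ = 1 := by omega
      have h21 : e₂ = 1 := by omega
      refine ⟨fun h => hfix h, ?_, hN⟩
      rw [hfac, h11, h21, pow_one, pow_one]
    · rw [hN, ← pow_mul] at hnorm
      have := hpinj hnorm
      omega

/-- **A prime dividing the discriminant of a quadratic field is the square of a prime of degree one**:
`p ∣ d_K ⇒ σ𝔭 = 𝔭` and `N𝔭 = p` for `𝔭 ∋ p` (if `p` were split or inert, `𝔭` would be coprime to its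
cofactor in `(p)` and hence prime to the different, `Mathlib.not_dvd_differentIdeal_of_isCoprime`,
contradicting `p ∣ d_K = N(𝔇)`). [cite: Marcus2018, Ch. 3, Thm. 25] -/
theorem smul_eq_and_absNorm_eq_of_dvd_discr (hK : Module.finrank ℚ K = 2) (σ : K ≃ₐ[ℚ] K) (hσ : σ ≠ 1)
    {p : ℕ} (hp : p.Prime) (hpd : (p : ℤ) ∣ discr K) (v : HeightOneSpectrum (𝓞 K))
    (hv : ((p : ℤ) : 𝓞 K) ∈ v.asIdeal) : σ • v = v ∧ Ideal.absNorm v.asIdeal = p := by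
  classical
  have hp' : Prime (p : ℤ) := Nat.prime_iff_prime_int.mp hp
  haveI hpmax : (Ideal.span {(p : ℤ)}).IsMaximal :=
    ((Ideal.span_singleton_prime (by exact_mod_cast hp.ne_zero)).mpr hp').isMaximal
      (by rw [Ne, Ideal.span_singleton_eq_bot]; exact_mod_cast hp.ne_zero)
  have hp0 : Ideal.span {(p : ℤ)} ≠ ⊥ := by
    rw [Ne, Ideal.span_singleton_eq_bot]; exact_mod_cast hp.ne_zero
  haveI : Finite (ℤ ⧸ Ideal.span {(p : ℤ)}) := Ideal.finiteQuotientOfFreeOfNeBot _ hp0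
  -- a ramified prime `Q ∋ p`
  have h := (NumberField.not_dvd_discr_iff_forall_mem K (𝓞 K) hp').not.mp (not_not.mpr hpd)
  push Not at h
  obtain ⟨Q, hQprime, hpQ, hQram⟩ := h
  have hQ0 : Q ≠ ⊥ := by
    intro h0
    rw [h0, Ideal.mem_bot] at hpQ
    exact hp.ne_zero (by exact_mod_cast hpQ)
  haveI : Q.IsMaximal := hQprime.isMaximal hQ0
  set w : HeightOneSpectrum (𝓞 K) := ⟨Q, hQprime, hQ0⟩ with hwdef
  have hw : ((p : ℤ) : 𝓞 K) ∈ w.asIdeal := hpQ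
  have hdiff : Q ∣ differentIdeal ℤ (𝓞 K) := dvd_differentIdeal_iff.mpr hQram
  have hmap : (Ideal.span {(p : ℤ)}).map (algebraMap ℤ (𝓞 K)) = Ideal.span {((p : ℤ) : 𝓞 K)} := by
    rw [Ideal.map_span, Set.image_singleton, eq_intCast]
  -- `w` is neither split nor inert
  have hwram : σ • w = w ∧ Ideal.absNorm w.asIdeal = p := by
    rcases quadratic_trichotomy hK σ hσ hp w hw with ⟨hne, hprod, -⟩ | ⟨-, hprod⟩ | ⟨hfix, -, hN⟩
    · exfalso
      refine not_dvd_differentIdeal_of_isCoprime ℤ (p := Ideal.span {(p : ℤ)}) Q (σ • w).asIdeal ?_ ?_ hdiff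
      · haveI := (σ • w).isMaximal
        exact (Ideal.isCoprime_iff_sup_eq.mpr (Ideal.IsMaximal.coprime_of_ne inferInstance inferInstance
          fun h => hne (HeightOneSpectrum.ext h).symm))
      · rw [hmap, hprod]
    · exfalso
      refine not_dvd_differentIdeal_of_isCoprime ℤ (p := Ideal.span {(p : ℤ)}) Q ⊤ ?_ ?_ hdiff
      · rw [← Ideal.one_eq_top]; exact isCoprime_one_right
      · rw [Ideal.mul_top, hmap, hprod]
    · exact ⟨hfix, hN⟩
  -- `v` is a conjugate of `w`, hence `v = w`
  rcases eq_or_eq_smul_of_mem hK σ hσ hp w hw v hv with h | h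
  · rw [h]; exact hwram
  · rw [h, hwram.1]; exact hwram

omit [IsGalois ℚ K] [NumberField K] in
/-- A product of elements `≡ 1 mod I` is `≡ 1 mod I`. [folklore] -/
theorem prod_sub_one_mem {ι : Type*} (I : Ideal (𝓞 K)) (s : Finset ι) (f : ι → 𝓞 K)
    (h : ∀ i ∈ s, f i - 1 ∈ I) : ∏ i ∈ s, f i - 1 ∈ I := by
  classical
  refine Finset.prod_induction _ (fun y => y - 1 ∈ I) ?_ (by simp) h
  intro a b ha hb
  have : a * b - 1 = (a - 1) * b + (b - 1) := by ring
  rw [this]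
  exact I.add_mem (I.mul_mem_right _ ha) hb

open scoped Classical in
/-- **Generators of `(𝓞_K/𝔪₀)ˣ` modulo rational integers, `K` quadratic.**  Let `K` be a quadratic
field, `d ≠ 0`, `T` the set of primes of `K` dividing `3d`, `𝔪₀ = (∏_{v ∈ T, v ∤ 3} 𝔭_v) · 9`, and
`Z` the set of rational integers prime to `T`.  There is a finite set `S` of integers prime to `T` with
`#S ≤ #(𝓞_K/9) + #{p ∣ d prime : p ∤ d_K}` such that every `x ∈ 𝓞_K` prime to `T` satisfies
`x ≡ a · ∏_{s ∈ S} s^{n_s} mod 𝔪₀` for some `a ∈ Z` and exponents `n_s`: for each prime `p ∣ d`,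
`p ≠ 3`, that is split (`(p) = 𝔭σ𝔭`: `a ≡ x mod σ𝔭`, one generator of `(𝓞_K/𝔭)ˣ`) or inert (one
generator of `(𝓞_K/p)ˣ`), and NO generator at the ramified primes (`(p) = 𝔭²`, `𝓞_K/𝔭 = 𝔽_p` is
represented by rational integers; `p ∣ d_K` forces this, `smul_eq_and_absNorm_eq_of_dvd_discr`);
plus representatives of the units modulo `9`; the Chinese remainder theorem in `ℤ` and in `𝓞_K` glues.
This is the hypothesis `hgen` of `ncard_cubicRayClassFunctions_le` for ring class characters, and the
source of the `ω(f)` in the `3`-rank bound. [cite: BelabasBhargavaPomerance2010, proof of Lemma 3.3] -/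
theorem exists_generators_baseModulus_quadratic (hK : Module.finrank ℚ K = 2) {d : ℤ} (hd : d ≠ 0)
    (T : Finset (HeightOneSpectrum (𝓞 K)))
    (hT : ∀ v : HeightOneSpectrum (𝓞 K), v ∈ T ↔ ((3 * d : ℤ) : 𝓞 K) ∈ v.asIdeal) :
    ∃ S : Finset (𝓞 K),
      S.card ≤ Nat.card (𝓞 K ⧸ Ideal.span {(9 : 𝓞 K)}) +
        (d.natAbs.primeFactors.filter fun p : ℕ => ¬ ((p : ℤ) ∣ discr K)).card ∧
      (∀ s ∈ S, ∀ v ∈ T, s ∉ v.asIdeal) ∧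
      ∀ x : 𝓞 K, (∀ v ∈ T, x ∉ v.asIdeal) →
        ∃ z ∈ {y : 𝓞 K | ∃ a : ℤ, y = a ∧ ∀ v ∈ T, ((a : ℤ) : 𝓞 K) ∉ v.asIdeal}, ∃ n : 𝓞 K → ℕ,
          x - z * ∏ s ∈ S, s ^ n s ∈
            (∏ v ∈ T.filter (fun v => (3 : 𝓞 K) ∉ v.asIdeal), v.asIdeal) * Ideal.span {(9 : 𝓞 K)} := by
  obtain ⟨σ, hσ⟩ := exists_ne_one_of_finrank_eq_two hK
  have hd0 : d.natAbs ≠ 0 := Int.natAbs_ne_zero.mpr hd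
  -- membership in `T` through the rational prime below
  have hTiff : ∀ (v : HeightOneSpectrum (𝓞 K)) (ℓ : ℕ), ℓ.Prime → ((ℓ : ℤ) : 𝓞 K) ∈ v.asIdeal →
      (v ∈ T ↔ ℓ ∣ 3 * d.natAbs) := by
    intro v ℓ hℓ hℓv
    obtain ⟨ℓ', hℓ', hiff⟩ := exists_ratPrime v
    have hℓℓ' : ℓ' = ℓ := by
      by_contra hne
      exact not_mem_of_prime_ne hℓ hℓ' (Ne.symm hne) v hℓv ((hiff ℓ').mpr dvd_rfl)
    subst hℓℓ'
    rw [hT, hiff, ← Int.natAbs_dvd_natAbs, Int.natAbs_natCast, Int.natAbs_mul]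
    rfl
  have hT3 : ∀ v : HeightOneSpectrum (𝓞 K), (3 : 𝓞 K) ∈ v.asIdeal → v ∈ T := fun v h3 =>
    (hT v).mpr (by rw [Int.cast_mul, Int.cast_ofNat]; exact Ideal.mul_mem_right _ _ h3)
  have hratT : ∀ v ∈ T, (3 : 𝓞 K) ∉ v.asIdeal → ∃ ℓ : ℕ, ℓ.Prime ∧ ℓ ≠ 3 ∧ ℓ ∣ d.natAbs ∧
      ((ℓ : ℤ) : 𝓞 K) ∈ v.asIdeal ∧ ∀ m : ℤ, ((m : ℤ) : 𝓞 K) ∈ v.asIdeal ↔ (ℓ : ℤ) ∣ m := by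
    intro v hv hv3
    obtain ⟨ℓ, hℓ, hiff⟩ := exists_ratPrime v
    have hℓv : ((ℓ : ℤ) : 𝓞 K) ∈ v.asIdeal := (hiff ℓ).mpr dvd_rfl
    have hℓ3 : ℓ ≠ 3 := by
      rintro rfl
      exact hv3 (by exact_mod_cast hℓv)
    have hdvd : ℓ ∣ 3 * d.natAbs := (hTiff v ℓ hℓ hℓv).mp hv
    exact ⟨ℓ, hℓ, hℓ3, (Nat.Coprime.dvd_of_dvd_mul_left ((Nat.coprime_primes hℓ Nat.prime_three).mpr hℓ3)
      hdvd), hℓv, hiff⟩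
  -- a prime of `K` above each rational prime
  have hch : ∀ p : ℕ, ∃ v : HeightOneSpectrum (𝓞 K), p.Prime → ((p : ℤ) : 𝓞 K) ∈ v.asIdeal := by
    intro p
    by_cases hp : p.Prime
    · obtain ⟨v, hv⟩ := exists_mem_of_prime (K := K) hp
      exact ⟨v, fun _ => hv⟩
    · obtain ⟨v, -⟩ := exists_mem_of_prime (K := K) Nat.prime_two
      exact ⟨v, fun h => absurd h hp⟩
  choose vp hvp using hch
  -- representatives modulo `9`, generators of the residue fields and their lifts
  obtain ⟨S₉, h9card, h9T, h9one, h9cov⟩ := exists_nine_representatives T hT3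
  choose g hgv hgen using fun v : HeightOneSpectrum (𝓞 K) => exists_generator_mod v
  set c : HeightOneSpectrum (𝓞 K) → ℕ := fun v =>
    (Associates.mk v.asIdeal).count (Associates.mk (Ideal.span {(9 : 𝓞 K)})).factors with hc
  have hlift : ∀ p : ℕ, ∃ y : 𝓞 K, ∀ w ∈ T,
      y - (if w = vp p then g (vp p) else 1) ∈ w.asIdeal ^ (if (3 : 𝓞 K) ∈ w.asIdeal then c w else 1) :=
    fun p => exists_forall_sub_mem_pow T _ _
  choose sg hsg using hlift
  -- the rational primes `p ∣ d`, `p ≠ 3`, and those needing a generator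
  set P0 : Finset ℕ := d.natAbs.primeFactors.filter (fun p => p ≠ 3) with hP0
  set Pgen : Finset ℕ := P0.filter (fun p => ¬ (σ • vp p = vp p ∧ Ideal.absNorm (vp p).asIdeal = p))
    with hPgen
  have hP0_prime : ∀ p ∈ P0, p.Prime := fun p hp =>
    Nat.prime_of_mem_primeFactors (Finset.mem_filter.mp hp).1
  have hP0_3 : ∀ p ∈ P0, p ≠ 3 := fun p hp => (Finset.mem_filter.mp hp).2
  have hP0_dvd : ∀ p ∈ P0, p ∣ d.natAbs := fun p hp =>
    Nat.dvd_of_mem_primeFactors (Finset.mem_filter.mp hp).1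
  have hP0_mem : ∀ ℓ : ℕ, ℓ.Prime → ℓ ≠ 3 → ℓ ∣ d.natAbs → ℓ ∈ P0 := fun ℓ hℓ hℓ3 hℓd =>
    Finset.mem_filter.mpr ⟨Nat.mem_primeFactors.mpr ⟨hℓ, hℓd, hd0⟩, hℓ3⟩
  have hPgen_P0 : ∀ p ∈ Pgen, p ∈ P0 := fun p hp => (Finset.mem_filter.mp hp).1
  have hvpP : ∀ p ∈ P0, ((p : ℤ) : 𝓞 K) ∈ (vp p).asIdeal := fun p hp => hvp p (hP0_prime p hp)
  have hvpT : ∀ p ∈ P0, vp p ∈ T := fun p hp =>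
    (hTiff (vp p) p (hP0_prime p hp) (hvpP p hp)).mpr (dvd_mul_of_dvd_right (hP0_dvd p hp) 3)
  have hσvpT : ∀ p ∈ P0, σ • vp p ∈ T := fun p hp =>
    (hTiff (σ • vp p) p (hP0_prime p hp) ((intCast_mem_smul_iff σ _ p).mpr (hvpP p hp))).mpr
      (dvd_mul_of_dvd_right (hP0_dvd p hp) 3)
  have hvp3 : ∀ p ∈ P0, (3 : 𝓞 K) ∉ (vp p).asIdeal := fun p hp h3 =>
    not_mem_of_prime_ne (hP0_prime p hp) Nat.prime_three (hP0_3 p hp) (vp p) (hvpP p hp)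
      (by exact_mod_cast h3)
  -- a prime of `T` away from `3` containing `p ∈ P0` is `vp p` or `σ • vp p`; distinct `p` give distinct primes
  have hne_vp : ∀ (w : HeightOneSpectrum (𝓞 K)) (ℓ : ℕ), ℓ.Prime → ((ℓ : ℤ) : 𝓞 K) ∈ w.asIdeal →
      ∀ q ∈ P0, q ≠ ℓ → w ≠ vp q := by
    intro w ℓ hℓ hℓw q hq hqℓ h
    exact not_mem_of_prime_ne (hP0_prime q hq) hℓ hqℓ (vp q) (hvpP q hq) (h ▸ hℓw)
  -- congruences of the lifted generators
  have hsg_self : ∀ p ∈ P0, sg p - g (vp p) ∈ (vp p).asIdeal := by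
    intro p hp
    have h := hsg p (vp p) (hvpT p hp)
    rwa [if_pos rfl, if_neg (hvp3 p hp), pow_one] at h
  have hsg_other : ∀ (p : ℕ) (w : HeightOneSpectrum (𝓞 K)), w ∈ T → w ≠ vp p →
      (3 : 𝓞 K) ∉ w.asIdeal → sg p - 1 ∈ w.asIdeal := by
    intro p w hw hwp hw3
    have h := hsg p w hw
    rwa [if_neg hwp, if_neg hw3, pow_one] at h
  have hsg_nine : ∀ p ∈ P0, sg p - 1 ∈ Ideal.span {(9 : 𝓞 K)} := by
    intro p hp
    rw [mem_span_nine_iff T hT3]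
    intro w hw hw3
    have hwp : w ≠ vp p := fun h => hvp3 p hp (h ▸ hw3)
    have h := hsg p w hw
    rwa [if_neg hwp, if_pos hw3] at h
  have hsgT : ∀ p ∈ P0, ∀ w ∈ T, sg p ∉ w.asIdeal := by
    intro p hp w hw hmem
    by_cases hwp : w = vp p
    · subst hwp
      have : g (vp p) = sg p - (sg p - g (vp p)) := by ring
      exact hgv (vp p) (this ▸ (vp p).asIdeal.sub_mem hmem (hsg_self p hp))
    · have h1 : sg p - 1 ∈ w.asIdeal := by
        by_cases hw3 : (3 : 𝓞 K) ∈ w.asIdeal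
        · exact (span_nine_le_iff w).mpr hw3 (hsg_nine p hp)
        · exact hsg_other p w hw hwp hw3
      have : (1 : 𝓞 K) = sg p - (sg p - 1) := by ring
      exact w.isPrime.ne_top ((Ideal.eq_top_iff_one _).mpr (this ▸ w.asIdeal.sub_mem hmem h1))
  refine ⟨S₉ ∪ Pgen.image sg, ?_, ?_, ?_⟩
  · -- the count: generators only at primes not dividing `d_K`
    have hsub : Pgen ⊆ d.natAbs.primeFactors.filter fun p : ℕ => ¬ ((p : ℤ) ∣ discr K) := by
      intro p hp
      obtain ⟨hp0, hpram⟩ := Finset.mem_filter.mp hp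
      refine Finset.mem_filter.mpr ⟨(Finset.mem_filter.mp hp0).1, fun hdisc => hpram ?_⟩
      exact smul_eq_and_absNorm_eq_of_dvd_discr hK σ hσ (hP0_prime p hp0) hdisc (vp p) (hvpP p hp0)
    calc (S₉ ∪ Pgen.image sg).card ≤ S₉.card + (Pgen.image sg).card := Finset.card_union_le _ _
      _ ≤ Nat.card (𝓞 K ⧸ Ideal.span {(9 : 𝓞 K)}) +
          (d.natAbs.primeFactors.filter fun p : ℕ => ¬ ((p : ℤ) ∣ discr K)).card :=
        add_le_add h9card (Finset.card_image_le.trans (Finset.card_le_card hsub))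
  · intro s hs w hw
    rcases Finset.mem_union.mp hs with hs | hs
    · exact h9T s hs w hw
    · obtain ⟨p, hp, rfl⟩ := Finset.mem_image.mp hs
      exact hsgT p (hPgen_P0 p hp) w hw
  · intro x hx
    -- Step A: rational integers `a p` matching `x` where the rational integers can
    have hap : ∀ p : ℕ, ∃ a : ℤ, p ∈ P0 →
        ¬ ((p : ℤ) ∣ a) ∧ (σ • vp p ≠ vp p → x - a ∈ (σ • vp p).asIdeal) ∧
          (σ • vp p = vp p → Ideal.absNorm (vp p).asIdeal = p → x - a ∈ (vp p).asIdeal) := by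
      intro p
      by_cases hp : p ∈ P0
      swap
      · exact ⟨1, fun h => absurd h hp⟩
      have hpp := hP0_prime p hp
      have hcast : ∀ {a : ℤ} (w : HeightOneSpectrum (𝓞 K)), ((p : ℤ) : 𝓞 K) ∈ w.asIdeal →
          (p : ℤ) ∣ a → ((a : ℤ) : 𝓞 K) ∈ w.asIdeal := by
        intro a w hw hpa
        obtain ⟨m, rfl⟩ := hpa
        rw [Int.cast_mul]
        exact Ideal.mul_mem_right _ _ hw
      have hxa : ∀ {a : ℤ} (w : HeightOneSpectrum (𝓞 K)), w ∈ T → x - a ∈ w.asIdeal →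
          ((a : ℤ) : 𝓞 K) ∈ w.asIdeal → False := by
        intro a w hw hxa haw
        refine hx w hw ?_
        have : x = (x - a) + a := by ring
        rw [this]
        exact w.asIdeal.add_mem hxa haw
      rcases quadratic_trichotomy hK σ hσ hpp (vp p) (hvpP p hp) with
        ⟨hne, -, hN⟩ | ⟨hfix, hspan⟩ | ⟨hfix, -, hN⟩
      · -- split: `a ≡ x mod σ𝔭`
        have hNσ : Ideal.absNorm (σ • vp p).asIdeal = p := by
          rw [absNorm_eq_card, HeightOneSpectrum.card_quotient_smul, ← absNorm_eq_card, hN]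
        have hpσ : ((p : ℤ) : 𝓞 K) ∈ (σ • vp p).asIdeal := (intCast_mem_smul_iff σ _ p).mpr (hvpP p hp)
        obtain ⟨a, ha⟩ := exists_int_sub_mem hpp (σ • vp p) hpσ hNσ x
        exact ⟨a, fun _ => ⟨fun hpa => hxa _ (hσvpT p hp) ha (hcast _ hpσ hpa), fun _ => ha,
          fun h => absurd h hne⟩⟩
      · -- inert: `a = 1`
        refine ⟨1, fun _ => ⟨fun h1 => hpp.one_lt.ne' ?_, fun h => absurd hfix h, fun _ hN => ?_⟩⟩
        · have := Int.eq_one_of_dvd_one (by positivity) h1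
          exact_mod_cast this
        · exfalso
          have h2 : Ideal.absNorm (vp p).asIdeal = p ^ 2 := by rw [← hspan, absNorm_span_natCast p, hK]
          rw [hN] at h2
          have := hpp.one_lt
          nlinarith
      · -- ramified: `a ≡ x mod 𝔭`
        obtain ⟨a, ha⟩ := exists_int_sub_mem hpp (vp p) (hvpP p hp) hN x
        exact ⟨a, fun _ => ⟨fun hpa => hxa _ (hvpT p hp) ha (hcast _ (hvpP p hp) hpa),
          fun h => absurd hfix h, fun _ _ => ha⟩⟩
    choose a ha using hap
    -- Step B: one rational integer `A ≡ a p mod p` (`p ∈ P0`), `A ≡ 1 mod 9`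
    obtain ⟨A, hAp, hA9⟩ : ∃ A : ℤ, (∀ p ∈ P0, (p : ℤ) ∣ A - a p) ∧ (9 : ℤ) ∣ A - 1 := by
      have hprime3 : ∀ j ∈ insert 3 P0, j.Prime := by
        intro j hj
        rcases Finset.mem_insert.mp hj with rfl | hj
        · exact Nat.prime_three
        · exact hP0_prime j hj
      have hprime : ∀ j ∈ insert 3 P0, Prime (Ideal.span {(j : ℤ)}) := fun j hj =>
        Ideal.prime_span_singleton_iff.mpr (Nat.prime_iff_prime_int.mp (hprime3 j hj))
      have hcop : ∀ i ∈ insert 3 P0, ∀ j ∈ insert 3 P0, i ≠ j →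
          Ideal.span {(i : ℤ)} ≠ Ideal.span {(j : ℤ)} := by
        intro i hi j hj hij h
        apply hij
        have hmem : (i : ℤ) ∈ Ideal.span {(j : ℤ)} := h ▸ Ideal.mem_span_singleton_self _
        rw [Ideal.mem_span_singleton, Int.natCast_dvd_natCast] at hmem
        exact ((Nat.prime_dvd_prime_iff_eq (hprime3 j hj) (hprime3 i hi)).mp hmem).symm
      obtain ⟨y, hy⟩ := IsDedekindDomain.exists_forall_sub_mem_ideal (s := insert 3 P0)
        (fun j : ℕ => Ideal.span {(j : ℤ)}) (fun j => if j = 3 then 2 else 1) hprime hcop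
        (fun j => if (j : ℕ) = 3 then 1 else a j)
      refine ⟨y, fun p hp => ?_, ?_⟩
      · have h := hy p (Finset.mem_insert_of_mem hp)
        simp only [if_neg (hP0_3 p hp), pow_one, Ideal.mem_span_singleton] at h
        exact h
      · have h := hy 3 (Finset.mem_insert_self _ _)
        have h2 : Ideal.span {((3 : ℕ) : ℤ)} ^ (if (3 : ℕ) = 3 then 2 else 1) = Ideal.span {(9 : ℤ)} := by
          rw [if_pos rfl, Ideal.span_singleton_pow]; norm_num
        rw [h2, Ideal.mem_span_singleton] at h
        simpa using h
    -- Step C: `A` is prime to `T`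
    have hAT : ∀ v ∈ T, ((A : ℤ) : 𝓞 K) ∉ v.asIdeal := by
      intro v hv hAv
      by_cases hv3 : (3 : 𝓞 K) ∈ v.asIdeal
      · -- `3 ∣ A` and `9 ∣ A - 1`
        obtain ⟨ℓ, hℓ, hiff⟩ := exists_ratPrime v
        have h3 : (ℓ : ℤ) ∣ 3 := (hiff 3).mp (by exact_mod_cast hv3)
        have hℓ3 : ℓ = 3 := by
          have := (Nat.prime_dvd_prime_iff_eq hℓ Nat.prime_three).mp (by exact_mod_cast h3)
          exact this
        subst hℓ3
        have hA3 : ((3 : ℕ) : ℤ) ∣ A := (hiff A).mp hAv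
        have : (3 : ℤ) ∣ 1 := by
          have h9 : (3 : ℤ) ∣ A - 1 := dvd_trans (by norm_num) hA9
          have h31 : (3 : ℤ) ∣ A - (A - 1) := dvd_sub (by exact_mod_cast hA3) h9
          rwa [sub_sub_cancel] at h31
        omega
      · obtain ⟨ℓ, hℓ, hℓ3, hℓd, hℓv, hiff⟩ := hratT v hv hv3
        have hℓP : ℓ ∈ P0 := hP0_mem ℓ hℓ hℓ3 hℓd
        have hA : (ℓ : ℤ) ∣ A := (hiff A).mp hAv
        have := dvd_sub hA (hAp ℓ hℓP)
        rw [sub_sub_cancel] at this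
        exact (ha ℓ hℓP).1 this
    -- Step D: exponents at the generators
    have hnorm2 : ∀ p ∈ P0, 2 ≤ Ideal.absNorm (vp p).asIdeal := by
      intro p hp
      have h2 := (hP0_prime p hp).two_le
      rcases absNorm_eq_or_of_mem hK (hP0_prime p hp) (vp p) (hvpP p hp) with h | h <;> rw [h] <;> nlinarith
    have hav : ∀ p ∈ P0, ((a p : ℤ) : 𝓞 K) ∉ (vp p).asIdeal := by
      intro p hp h
      refine (ha p hp).1 ?_
      have : (a p : ℤ) ∈ (vp p).asIdeal.under ℤ := by
        rw [Ideal.mem_comap, eq_intCast]; exact h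
      rw [under_eq_span_of_mem (hP0_prime p hp) (vp p) (hvpP p hp), Ideal.mem_span_singleton] at this
      exact this
    have hnp : ∀ p : ℕ, ∃ n : ℕ, p ∈ P0 →
        x * ((a p : ℤ) : 𝓞 K) ^ (Ideal.absNorm (vp p).asIdeal - 2) - g (vp p) ^ n ∈ (vp p).asIdeal := by
      intro p
      by_cases hp : p ∈ P0
      swap
      · exact ⟨0, fun h => absurd h hp⟩
      obtain ⟨n, hn⟩ := hgen (vp p) (x * ((a p : ℤ) : 𝓞 K) ^ (Ideal.absNorm (vp p).asIdeal - 2))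
        (fun h => ((vp p).isPrime.mem_or_mem h).elim (hx _ (hvpT p hp))
          (fun h' => hav p hp ((vp p).isPrime.mem_of_pow_mem _ h')))
      exact ⟨n, fun _ => hn⟩
    choose n hn using hnp
    -- Step E: the representative modulo `9` and the monomial
    obtain ⟨s, hs, hxs⟩ := h9cov x hx
    set Pm := ∏ p ∈ Pgen, sg p ^ n p with hPm
    obtain ⟨n₁, hn₁⟩ := exists_prod_pow_eq Pgen sg n (S₉ ∪ Pgen.image sg)
      fun p hp => Finset.mem_union_right _ (Finset.mem_image_of_mem _ hp)
    obtain ⟨n₂, hn₂⟩ := exists_prod_pow_eq ({s} : Finset (𝓞 K)) id (fun _ => 1) (S₉ ∪ Pgen.image sg)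
      fun y hy => by rw [Finset.mem_singleton.mp hy]; exact Finset.mem_union_left _ hs
    refine ⟨(A : 𝓞 K), ⟨A, rfl, hAT⟩, fun y => n₁ y + n₂ y, ?_⟩
    have hprod : ∏ y ∈ S₉ ∪ Pgen.image sg, y ^ (n₁ y + n₂ y) = Pm * s := by
      simp_rw [pow_add]
      rw [Finset.prod_mul_distrib, ← hn₁, ← hn₂, hPm]
      simp
    rw [hprod]
    -- `Pm ≡ 1` at the primes of `T` other than the `vp q`, `q ∈ Pgen`
    have hPm_one : ∀ w ∈ T, (3 : 𝓞 K) ∉ w.asIdeal → (∀ q ∈ Pgen, w ≠ vp q) → Pm - 1 ∈ w.asIdeal :=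
      fun w hw hw3 hwq => prod_sub_one_mem _ _ _ fun q hq =>
        sub_one_pow_mem_of_sub_one_mem (hsg_other q w hw (hwq q hq) hw3) _
    have hPm_nine : Pm - 1 ∈ Ideal.span {(9 : 𝓞 K)} :=
      prod_sub_one_mem _ _ _ fun q hq => sub_one_pow_mem_of_sub_one_mem (hsg_nine q (hPgen_P0 q hq)) _
    have hA9' : ((A : ℤ) : 𝓞 K) - 1 ∈ Ideal.span {(9 : 𝓞 K)} := by
      obtain ⟨m, hm⟩ := hA9
      rw [Ideal.mem_span_singleton]
      refine ⟨(m : 𝓞 K), ?_⟩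
      have : ((A - 1 : ℤ) : 𝓞 K) = ((9 * m : ℤ) : 𝓞 K) := by rw [hm]
      push_cast at this
      exact this
    refine mem_baseModulus_of T hT3 (fun w hw hw3 => ?_) ?_
    · -- at a prime `w ∤ 3` of `T`, above `ℓ ∈ P0`
      obtain ⟨ℓ, hℓ, hℓ3, hℓd, hℓw, hiff⟩ := hratT w hw hw3
      have hℓP : ℓ ∈ P0 := hP0_mem ℓ hℓ hℓ3 hℓd
      have hAa : ((A : ℤ) : 𝓞 K) - a ℓ ∈ w.asIdeal := by
        have := (hiff (A - a ℓ)).mpr (hAp ℓ hℓP)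
        push_cast at this
        exact this
      have hs1 : s - 1 ∈ w.asIdeal := h9one s hs w hw hw3
      -- pass to the residue field
      rw [← Ideal.Quotient.eq_zero_iff_mem]
      have qA : Ideal.Quotient.mk w.asIdeal ((A : ℤ) : 𝓞 K) = Ideal.Quotient.mk w.asIdeal (a ℓ : 𝓞 K) :=
        (Ideal.Quotient.eq).mpr hAa
      have qs : Ideal.Quotient.mk w.asIdeal s = 1 := by
        rw [← map_one (Ideal.Quotient.mk w.asIdeal)]; exact (Ideal.Quotient.eq).mpr hs1
      by_cases hwv : w = vp ℓ
      · by_cases hℓgen : ℓ ∈ Pgen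
        · -- `w = vp ℓ`, generator present: `a γⁿ ≡ a · x a^{N-2} = x a^{N-1} ≡ x`
          have hPm' : Pm = sg ℓ ^ n ℓ * ∏ q ∈ Pgen.erase ℓ, sg q ^ n q :=
            (Finset.mul_prod_erase Pgen (fun q => sg q ^ n q) hℓgen).symm
          have hrest : (∏ q ∈ Pgen.erase ℓ, sg q ^ n q) - 1 ∈ w.asIdeal :=
            prod_sub_one_mem _ _ _ fun q hq => sub_one_pow_mem_of_sub_one_mem
              (hsg_other q w hw (hne_vp w ℓ hℓ hℓw q (hPgen_P0 q (Finset.mem_of_mem_erase hq))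
                (Finset.ne_of_mem_erase hq)) hw3) _
          have qrest : Ideal.Quotient.mk w.asIdeal (∏ q ∈ Pgen.erase ℓ, sg q ^ n q) = 1 := by
            rw [← map_one (Ideal.Quotient.mk w.asIdeal)]; exact (Ideal.Quotient.eq).mpr hrest
          have qsg : Ideal.Quotient.mk w.asIdeal (sg ℓ) = Ideal.Quotient.mk w.asIdeal (g (vp ℓ)) :=
            (Ideal.Quotient.eq).mpr (hwv ▸ hsg_self ℓ hℓP)
          have qg : Ideal.Quotient.mk w.asIdeal (g (vp ℓ)) ^ n ℓ = Ideal.Quotient.mk w.asIdeal x *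
              Ideal.Quotient.mk w.asIdeal (a ℓ : 𝓞 K) ^ (Ideal.absNorm (vp ℓ).asIdeal - 2) := by
            rw [← map_pow, ← map_pow, ← map_mul]
            exact ((Ideal.Quotient.eq).mpr (hwv ▸ hn ℓ hℓP)).symm
          have qF : Ideal.Quotient.mk w.asIdeal (a ℓ : 𝓞 K) ^ (Ideal.absNorm (vp ℓ).asIdeal - 1) = 1 := by
            rw [← map_pow, ← map_one (Ideal.Quotient.mk w.asIdeal)]
            exact (Ideal.Quotient.eq).mpr (hwv ▸ pow_absNorm_sub_one_sub_one_mem (vp ℓ) (hav ℓ hℓP))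
          have hN1 : Ideal.absNorm (vp ℓ).asIdeal - 1 = (Ideal.absNorm (vp ℓ).asIdeal - 2) + 1 := by
            have := hnorm2 ℓ hℓP; omega
          rw [hN1, pow_succ] at qF
          rw [hPm', map_sub, map_mul, map_mul, map_mul, map_pow, qA, qsg, qg, qrest, qs, mul_one, mul_one]
          calc Ideal.Quotient.mk w.asIdeal x - Ideal.Quotient.mk w.asIdeal (a ℓ : 𝓞 K) *
                (Ideal.Quotient.mk w.asIdeal x * Ideal.Quotient.mk w.asIdeal (a ℓ : 𝓞 K) ^
                  (Ideal.absNorm (vp ℓ).asIdeal - 2))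
              = Ideal.Quotient.mk w.asIdeal x * (1 - Ideal.Quotient.mk w.asIdeal (a ℓ : 𝓞 K) ^
                  (Ideal.absNorm (vp ℓ).asIdeal - 2) * Ideal.Quotient.mk w.asIdeal (a ℓ : 𝓞 K)) := by ring
            _ = 0 := by rw [qF, sub_self, mul_zero]
        · -- `w = vp ℓ`, no generator: ramified, `x ≡ a ℓ ≡ A`
          have hram : σ • vp ℓ = vp ℓ ∧ Ideal.absNorm (vp ℓ).asIdeal = ℓ := by
            by_contra h
            exact hℓgen (Finset.mem_filter.mpr ⟨hℓP, h⟩)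
          have hxa := (ha ℓ hℓP).2.2 hram.1 hram.2
          have hPm1 : Pm - 1 ∈ w.asIdeal := hPm_one w hw hw3 fun q hq h =>
            hℓgen (by
              have := hne_vp w ℓ hℓ hℓw q (hPgen_P0 q hq)
              by_cases hqℓ : q = ℓ
              · exact hqℓ ▸ hq
              · exact absurd h (this hqℓ))
          have qPm : Ideal.Quotient.mk w.asIdeal Pm = 1 := by
            rw [← map_one (Ideal.Quotient.mk w.asIdeal)]; exact (Ideal.Quotient.eq).mpr hPm1
          have qx : Ideal.Quotient.mk w.asIdeal x = Ideal.Quotient.mk w.asIdeal (a ℓ : 𝓞 K) :=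
            (Ideal.Quotient.eq).mpr (hwv ▸ hxa)
          rw [map_sub, map_mul, map_mul, qA, qPm, qs, mul_one, mul_one, qx, sub_self]
      · -- `w = σ • vp ℓ ≠ vp ℓ`: split, `x ≡ a ℓ ≡ A`
        have hwσ : w = σ • vp ℓ := by
          rcases eq_or_eq_smul_of_mem hK σ hσ hℓ (vp ℓ) (hvpP ℓ hℓP) w hℓw with h | h
          · exact absurd h hwv
          · exact h
        have hne : σ • vp ℓ ≠ vp ℓ := fun h => hwv (hwσ.trans h)
        have hxa := (ha ℓ hℓP).2.1 hne
        have hPm1 : Pm - 1 ∈ w.asIdeal := hPm_one w hw hw3 fun q hq h => by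
          by_cases hqℓ : q = ℓ
          · exact hwv (hqℓ ▸ h)
          · exact hne_vp w ℓ hℓ hℓw q (hPgen_P0 q hq) hqℓ h
        have qPm : Ideal.Quotient.mk w.asIdeal Pm = 1 := by
          rw [← map_one (Ideal.Quotient.mk w.asIdeal)]; exact (Ideal.Quotient.eq).mpr hPm1
        have qx : Ideal.Quotient.mk w.asIdeal x = Ideal.Quotient.mk w.asIdeal (a ℓ : 𝓞 K) :=
          (Ideal.Quotient.eq).mpr (hwσ ▸ hxa)
        rw [map_sub, map_mul, map_mul, qA, qPm, qs, mul_one, mul_one, qx, sub_self]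
    · -- modulo `9`: `A ≡ 1`, `Pm ≡ 1`, `s ≡ x`
      have : x - (A : 𝓞 K) * (Pm * s) =
          (x - s) - s * (((A : 𝓞 K) - 1) * Pm + (Pm - 1)) := by ring
      rw [this]
      refine Ideal.sub_mem _ hxs (Ideal.mul_mem_left _ _ (Ideal.add_mem _ (Ideal.mul_mem_right _ _ ?_) hPm_nine))
      exact_mod_cast hA9'

end Quadratic

end Literature.NumberTheory.LFunctions

end
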